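import Summits.FinalStateConjecture.FinalStateConjecture.Theorems.WeakCosmicCensorship
import HarnessLib

/-!
# Cosmic censorship — consequences of the weak cosmic censorship CONJECTURE (gr.S02 / gr.S03)

Companion of `Literature/Geometry/Lorentzian/CosmicCensorship.lean` (the VOCABULARY: the admissible
class `IsAdmissibleWCCData`, the registered open statement `NegWeakCosmicCensorshipCodim`, the
weighted-Sobolev predicates `WeakCosmicCensorshipTop` / `NegWeakCosmicCensorship`, strong cosmic
censorship). By the conjecture/notion split (coordinator ruling 2026-08-15: unproven conjectures are
obligations of our theories, not literature facts) the closed conjecture gr.S02 is declared ONLY in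
the conjecture leaf `Summits/FinalStateConjecture/FinalStateConjecture/Theorems/WeakCosmicCensorship.lean`
as `Summit.FinalStateConjecture.FinalStateConjecture.WeakCosmicCensorship`; that leaf imports the
vocabulary file, so every Literature declaration that MENTIONS the conjecture lives here, importing
the leaf (a conjecture leaf — nothing but `@[conjecture]` definitions — is the one kind of `Summits`
module a Literature file may import).

Contents (moved verbatim from `CosmicCensorship.lean`, statement and proof unchanged except that
`WeakCosmicCensorship` now denotes the leaf's declaration):

* `negWeakCosmicCensorshipCodim_iff : NegWeakCosmicCensorshipCodim ↔ ¬ WeakCosmicCensorship` —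
  the finite-codimension negation form gr.S03 is exactly the negation of Christodoulou's generic
  weak cosmic censorship gr.S02 [cite: Christodoulou1999, p. A27].

No definition, no named fact, no `sorry`; nothing here asserts the conjecture or its negation.
-/

noncomputable section

open Manifold Bundle TopologicalSpace
open scoped ContDiff Topology

namespace Literature.Geometry.Lorentzian

/-- The finite-codimension negation of weak cosmic censorship is the negation of
`WeakCosmicCensorship` (unfold `IsChristodoulouGeneric` and push the negation through the
quantifiers). Christodoulou, CQG 16 (1999) A23, p. A27. [cite: Christodoulou1999, p. A27] -/
theorem negWeakCosmicCensorshipCodim_iff :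
    NegWeakCosmicCensorshipCodim ↔
      ¬ Summit.FinalStateConjecture.FinalStateConjecture.WeakCosmicCensorship := by
  have key : ∀ (X : Type) [TopologicalSpace X] [ChartedSpace E3 X] [IsManifold (𝓡 3) ∞ X]
      [T2Space X] [SecondCountableTopology X] [ConnectedSpace X],
      {D | D ∈ IsAdmissibleWCCData X ∧ ∃ 𝒟 : VacuumDevelopment D, 𝒟.IsMaximal ∧
        𝒟.toDevelopment.HasIncompleteFutureNullInfinity} =
      {D ∈ IsAdmissibleWCCData X | ¬ ∀ 𝒟 : VacuumDevelopment D, 𝒟.IsMaximal →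
        𝒟.toDevelopment.HasCompleteFutureNullInfinity} := by
    intro X _ _ _ _ _ _
    ext D
    simp only [Set.mem_setOf_eq, not_forall, exists_prop,
      Development.HasIncompleteFutureNullInfinity]
  constructor
  · rintro ⟨X, _, _, _, _, _, _, hX⟩ hW
    exact hX ((key X) ▸ hW X)
  · intro hW
    by_contra hN
    refine hW fun X i₁ i₂ i₃ i₄ i₅ i₆ ↦ ?_
    by_contra hX
    refine hN ⟨X, i₁, i₂, i₃, i₄, i₅, i₆, fun hS ↦ hX ?_⟩
    unfold InitialDataSet.IsChristodoulouGeneric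
    rw [← key X]
    exact hS

/-- Contrapositive packaging: weak cosmic censorship (the leaf's conjecture) refutes the
finite-codimension negation form. [cite: Christodoulou1999, p. A27] -/
theorem not_negWeakCosmicCensorshipCodim_of_weakCosmicCensorship
    (h : Summit.FinalStateConjecture.FinalStateConjecture.WeakCosmicCensorship) :
    ¬ NegWeakCosmicCensorshipCodim :=
  fun hN ↦ negWeakCosmicCensorshipCodim_iff.mp hN h

end Literature.Geometry.Lorentzian

end
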